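import Mathlib
import HarnessLib
import Summits.AnomalousDissipation.AnomalousDissipation.Theses.DyadicWallCascade
import Summits.AnomalousDissipation.AnomalousDissipation.Theorems.DyadicWallCascadeDyadicRealisationZeroStress

/-!
# Stub `stub_zeroStressSplit` of line `SketchIdeator4` — crux stmt-AnomalousDissipation-17917
  (`ViscousContinuation`)

The ZERO-STRESS SPLIT of the crux `DyadicWallCascade.ViscousContinuation` (route DyadicWallCascade,
`Summits/AnomalousDissipation`), registered certificate stub of line `SketchIdeator4`
(`Cruxes/ViscousContinuation/Lines/SketchIdeator4.lean`).

The crux reads `HalfSpaceHierarchy → ⟨ViscousWallProfile block⟩`, and its conclusion RE-QUANTIFIES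
the hierarchy `(V, Q, C, F)`.  By the landed `stub_zeroStress`
(`Theorems/DyadicWallCascadeDyadicRealisationZeroStress.lean`) the blow-down hierarchy of every
viscous wall profile has ZERO Reynolds stress `∫_{[0,1]²} V₂V₀(q,1) dq = ∫_{[0,1]²} V₂V₁(q,1) dq =
  0`,
a clause the hypothesis `HalfSpaceHierarchy` does not carry.  Consequently:

* `zeroStressHierarchy_of_viscousContinuation` — the crux implies the Euler-side statement
  "some half-space hierarchy ⇒ a ZERO-STRESS half-space hierarchy" (stress removal);
* `stub_zeroStressSplit` — the crux is EQUIVALENT to the conjunction of the two registered open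
  stubs of the line, `stub_stressRemoval` (Euler side) and `stub_zeroStressContinuation`
  (Navier–Stokes side: a zero-stress hierarchy continues to a viscous wall profile).

So the split is lossless: any proof of the crux as typed proves stress removal, and the
Navier–Stokes content of the crux is exactly the continuation of a ZERO-STRESS hierarchy.
All clause blocks are the route's, `let`-inlined (`X ∈ {X | 0 < X 2}` unfolds to `0 < X 2`).
-/

-- `Summit.<Summit>.<Problem>`: single-conjunct summit; the duplicate namespace is mandated.
set_option linter.dupNamespace false

noncomputable section

namespace Summit.AnomalousDissipation.AnomalousDissipation.Theorems

open MeasureTheory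
open Summit.AnomalousDissipation.AnomalousDissipation.Theses.DyadicWallCascade

/-- Euclidean 3-space (local notation, as in the registered stub signature). -/
local notation "E³" => EuclideanSpace ℝ (Fin 3)

/-- **The hidden Euler-side content of the crux: stress removal.**  If `ViscousContinuation` holds,
then every half-space hierarchy yields a half-space hierarchy with ZERO Reynolds stress on the unit
square of the plane `z = 1` — namely the blow-down hierarchy of the viscous wall profile the crux
produces, which is stress-free by the landed `stub_zeroStress` (tested horizontal momentum at every
dyadic scale + mirror symmetry). [folklore] -/
theorem zeroStressHierarchy_of_viscousContinuation (h : ViscousContinuation) : HalfSpaceHierarchy →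
    ∃ (V : E³ → E³) (Q : E³ → ℝ)
      (C F : ℝ),
      (ContDiffOn ℝ ((⊤ : ℕ∞) : WithTop ℕ∞) V {X : E³ | 0 < X 2} ∧
        ContDiffOn ℝ ((⊤ : ℕ∞) : WithTop ℕ∞) Q {X : E³ | 0 < X 2} ∧
        (∀ X : E³, 0 < X 2 → ‖V X‖ ≤ C ∧ |Q X| ≤ C) ∧
        (∀ X : E³, 0 < X 2 → ∑ i : Fin 3, (fderiv ℝ V X
          (EuclideanSpace.single i (1 : ℝ))) i = 0) ∧
        (∀ X : E³, 0 < X 2 → (fderiv ℝ V X) (V X) + gradient Q X = 0) ∧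
        (∀ X : E³, 0 < X 2 → V ((2 : ℝ) • X) = V X ∧ Q ((2 : ℝ) • X) = Q X) ∧
        (∀ X : E³, 1 ≤ X 2 → X 2 ≤ 2 →
          V (X + EuclideanSpace.single 0 (1 : ℝ)) = V X ∧ V (X + EuclideanSpace.single 1 (1 : ℝ)) =
            V X ∧
          Q (X + EuclideanSpace.single 0 (1 : ℝ)) = Q X ∧ Q (X + EuclideanSpace.single 1 (1 : ℝ)) =
            Q X) ∧
        (∫ q in Set.Icc (0 : ℝ) 1 ×ˢ Set.Icc (0 : ℝ) 1, (V !₂[q.1, q.2, (1 : ℝ)]) 2 = 0) ∧ F ≠ 0 ∧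
        (∫ q in Set.Icc (0 : ℝ) 1 ×ˢ Set.Icc (0 : ℝ) 1,
          (V !₂[q.1, q.2, (1 : ℝ)]) 2 * (‖V !₂[q.1, q.2, (1 : ℝ)]‖ ^ 2 / 2 + Q !₂[q.1, q.2, (1 :
            ℝ)]) = F)) ∧
      (∫ q in Set.Icc (0 : ℝ) 1 ×ˢ Set.Icc (0 : ℝ) 1, (V !₂[q.1, q.2, (1 : ℝ)]) 2 * (V !₂[q.1, q.2,
        (1 : ℝ)]) 0 = 0) ∧
      (∫ q in Set.Icc (0 : ℝ) 1 ×ˢ Set.Icc (0 : ℝ) 1, (V !₂[q.1, q.2, (1 : ℝ)]) 2 * (V !₂[q.1, q.2,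
        (1 : ℝ)]) 1 = 0) := by
  intro hH
  obtain ⟨W, P, V, Q, C, F, C', hB, hW, hP, hWb, hmir, hdiv, hNS, hbd⟩ := h hH
  obtain ⟨hVs, hQs, hbdd, hVdiv, hEul, hdil, hper, hmass, hF, hflux⟩ := hB
  have hz := stub_zeroStress W P V Q C F C'
    ⟨⟨hVs, hQs, hbdd, hVdiv, hEul, hdil, hper, hmass, hF, hflux⟩, hW, hP, hWb, hmir, hdiv, hNS, hbd⟩
  exact ⟨V, Q, C, F, ⟨hVs, hQs, hbdd, hVdiv, hEul, hdil, hper, hmass, hF, hflux⟩, hz.1, hz.2⟩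

/-- **Zero-stress split of the crux** (registered certificate stub `stub_zeroStressSplit` of line
`SketchIdeator4`, crux stmt-AnomalousDissipation-17917).  `ViscousContinuation` is equivalent to the
conjunction of (1) STRESS REMOVAL — some half-space hierarchy ⇒ a half-space hierarchy with zero
Reynolds stress `∫V₂V₀ = ∫V₂V₁ = 0` on the unit square of `z = 1` (registered stub
`stub_stressRemoval`) — and (2) ZERO-STRESS CONTINUATION — a zero-stress half-space hierarchy
continues to a viscous wall profile (registered stub `stub_zeroStressContinuation`).
`→`: (1) is `zeroStressHierarchy_of_viscousContinuation`; (2) because a zero-stress hierarchy is in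
particular a hierarchy.  `←`: compose.  [folklore] -/
theorem stub_zeroStressSplit : ViscousContinuation ↔
    ((HalfSpaceHierarchy →
      ∃ (V : E³ → E³) (Q : E³ →
        ℝ) (C F : ℝ),
        (ContDiffOn ℝ ((⊤ : ℕ∞) : WithTop ℕ∞) V {X : E³ | 0 < X 2} ∧
          ContDiffOn ℝ ((⊤ : ℕ∞) : WithTop ℕ∞) Q {X : E³ | 0 < X 2} ∧
          (∀ X : E³, 0 < X 2 → ‖V X‖ ≤ C ∧ |Q X| ≤ C) ∧
          (∀ X : E³, 0 < X 2 → ∑ i : Fin 3, (fderiv ℝ V X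
            (EuclideanSpace.single i (1 : ℝ))) i = 0) ∧
          (∀ X : E³, 0 < X 2 → (fderiv ℝ V X) (V X) + gradient Q X = 0) ∧
          (∀ X : E³, 0 < X 2 → V ((2 : ℝ) • X) = V X ∧ Q ((2 : ℝ) • X) = Q X)
            ∧
          (∀ X : E³, 1 ≤ X 2 → X 2 ≤ 2 →
            V (X + EuclideanSpace.single 0 (1 : ℝ)) = V X ∧ V (X + EuclideanSpace.single 1 (1 : ℝ))
              = V X ∧
            Q (X + EuclideanSpace.single 0 (1 : ℝ)) = Q X ∧ Q (X + EuclideanSpace.single 1 (1 : ℝ))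
              = Q X) ∧
          (∫ q in Set.Icc (0 : ℝ) 1 ×ˢ Set.Icc (0 : ℝ) 1, (V !₂[q.1, q.2, (1 : ℝ)]) 2 = 0) ∧ F ≠ 0 ∧
          (∫ q in Set.Icc (0 : ℝ) 1 ×ˢ Set.Icc (0 : ℝ) 1,
            (V !₂[q.1, q.2, (1 : ℝ)]) 2 * (‖V !₂[q.1, q.2, (1 : ℝ)]‖ ^ 2 / 2 + Q !₂[q.1, q.2, (1 :
              ℝ)]) = F)) ∧
        (∫ q in Set.Icc (0 : ℝ) 1 ×ˢ Set.Icc (0 : ℝ) 1, (V !₂[q.1, q.2, (1 : ℝ)]) 2 * (V !₂[q.1,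
          q.2, (1 : ℝ)]) 0 = 0) ∧
        (∫ q in Set.Icc (0 : ℝ) 1 ×ˢ Set.Icc (0 : ℝ) 1, (V !₂[q.1, q.2, (1 : ℝ)]) 2 * (V !₂[q.1,
          q.2, (1 : ℝ)]) 1 = 0)) ∧
    ((∃ (V : E³ → E³) (Q : E³ →
      ℝ) (C F : ℝ),
      (ContDiffOn ℝ ((⊤ : ℕ∞) : WithTop ℕ∞) V {X : E³ | 0 < X 2} ∧
        ContDiffOn ℝ ((⊤ : ℕ∞) : WithTop ℕ∞) Q {X : E³ | 0 < X 2} ∧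
        (∀ X : E³, 0 < X 2 → ‖V X‖ ≤ C ∧ |Q X| ≤ C) ∧
        (∀ X : E³, 0 < X 2 → ∑ i : Fin 3, (fderiv ℝ V X
          (EuclideanSpace.single i (1 : ℝ))) i = 0) ∧
        (∀ X : E³, 0 < X 2 → (fderiv ℝ V X) (V X) + gradient Q X = 0) ∧
        (∀ X : E³, 0 < X 2 → V ((2 : ℝ) • X) = V X ∧ Q ((2 : ℝ) • X) = Q X) ∧
        (∀ X : E³, 1 ≤ X 2 → X 2 ≤ 2 →
          V (X + EuclideanSpace.single 0 (1 : ℝ)) = V X ∧ V (X + EuclideanSpace.single 1 (1 : ℝ)) =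
            V X ∧
          Q (X + EuclideanSpace.single 0 (1 : ℝ)) = Q X ∧ Q (X + EuclideanSpace.single 1 (1 : ℝ)) =
            Q X) ∧
        (∫ q in Set.Icc (0 : ℝ) 1 ×ˢ Set.Icc (0 : ℝ) 1, (V !₂[q.1, q.2, (1 : ℝ)]) 2 = 0) ∧ F ≠ 0 ∧
        (∫ q in Set.Icc (0 : ℝ) 1 ×ˢ Set.Icc (0 : ℝ) 1,
          (V !₂[q.1, q.2, (1 : ℝ)]) 2 * (‖V !₂[q.1, q.2, (1 : ℝ)]‖ ^ 2 / 2 + Q !₂[q.1, q.2, (1 :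
            ℝ)]) = F)) ∧
      (∫ q in Set.Icc (0 : ℝ) 1 ×ˢ Set.Icc (0 : ℝ) 1, (V !₂[q.1, q.2, (1 : ℝ)]) 2 * (V !₂[q.1, q.2,
        (1 : ℝ)]) 0 = 0) ∧
      (∫ q in Set.Icc (0 : ℝ) 1 ×ˢ Set.Icc (0 : ℝ) 1, (V !₂[q.1, q.2, (1 : ℝ)]) 2 * (V !₂[q.1, q.2,
        (1 : ℝ)]) 1 = 0)) →
    ∃ (W : E³ → E³) (P : E³ → ℝ)
      (V : E³ → E³) (Q : E³ → ℝ)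
      (C F C' : ℝ),
      (ContDiffOn ℝ ((⊤ : ℕ∞) : WithTop ℕ∞) V {X : E³ | 0 < X 2} ∧
        ContDiffOn ℝ ((⊤ : ℕ∞) : WithTop ℕ∞) Q {X : E³ | 0 < X 2} ∧
        (∀ X : E³, 0 < X 2 → ‖V X‖ ≤ C ∧ |Q X| ≤ C) ∧
        (∀ X : E³, 0 < X 2 → ∑ i : Fin 3, (fderiv ℝ V X
          (EuclideanSpace.single i (1 : ℝ))) i = 0) ∧
        (∀ X : E³, 0 < X 2 → (fderiv ℝ V X) (V X) + gradient Q X = 0) ∧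
        (∀ X : E³, 0 < X 2 → V ((2 : ℝ) • X) = V X ∧ Q ((2 : ℝ) • X) = Q X) ∧
        (∀ X : E³, 1 ≤ X 2 → X 2 ≤ 2 →
          V (X + EuclideanSpace.single 0 (1 : ℝ)) = V X ∧ V (X + EuclideanSpace.single 1 (1 : ℝ)) =
            V X ∧
          Q (X + EuclideanSpace.single 0 (1 : ℝ)) = Q X ∧ Q (X + EuclideanSpace.single 1 (1 : ℝ)) =
            Q X) ∧
        (∫ q in Set.Icc (0 : ℝ) 1 ×ˢ Set.Icc (0 : ℝ) 1, (V !₂[q.1, q.2, (1 : ℝ)]) 2 = 0) ∧ F ≠ 0 ∧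
        (∫ q in Set.Icc (0 : ℝ) 1 ×ˢ Set.Icc (0 : ℝ) 1,
          (V !₂[q.1, q.2, (1 : ℝ)]) 2 * (‖V !₂[q.1, q.2, (1 : ℝ)]‖ ^ 2 / 2 + Q !₂[q.1, q.2, (1 :
            ℝ)]) = F)) ∧
      ContDiff ℝ ((⊤ : ℕ∞) : WithTop ℕ∞) W ∧ ContDiff ℝ ((⊤ : ℕ∞) : WithTop ℕ∞) P ∧
      (∀ X : E³, ‖W X‖ ≤ C' ∧ |P X| ≤ C') ∧
      (∀ X : E³, W (X - (2 * X 2) • EuclideanSpace.single 2 (1 : ℝ)) =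
          W X - (2 * (W X) 2) • EuclideanSpace.single 2 (1 : ℝ) ∧
        P (X - (2 * X 2) • EuclideanSpace.single 2 (1 : ℝ)) = P X) ∧
      (∀ X : E³, ∑ i : Fin 3, (fderiv ℝ W X (EuclideanSpace.single i (1 :
        ℝ))) i = 0) ∧
      (∀ X : E³, (fderiv ℝ W X) (W X) + gradient P X =
        ∑ i : Fin 3, fderiv ℝ (fun Y => fderiv ℝ W Y (EuclideanSpace.single i (1 : ℝ))) X
          (EuclideanSpace.single i (1 : ℝ))) ∧
      (∀ ε : ℝ, 0 < ε → ∃ M : ℕ, ∀ m : ℕ, M ≤ m → ∀ X : E³, 1 ≤ X 2 → X 2 ≤ 2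
        →
        ‖W ((2 : ℝ) ^ m • X) - V X‖ ≤ ε ∧ |P ((2 : ℝ) ^ m • X) - Q X| ≤ ε))) := by
  constructor
  · intro h
    refine ⟨zeroStressHierarchy_of_viscousContinuation h, ?_⟩
    rintro ⟨V, Q, C, F, hB, -, -⟩
    obtain ⟨hVs, hQs, hbdd, hVdiv, hEul, hdil, hper, hmass, hF, hflux⟩ := hB
    obtain ⟨W, P, V', Q', C₁, F₁, C', hB', hW, hP, hWb, hmir, hdiv, hNS, hbd⟩ :=
      h ⟨V, Q, C, F, hVs, hQs, hbdd, hVdiv, hEul, hdil, hper, hmass, hF, hflux⟩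
    exact ⟨W, P, V', Q', C₁, F₁, C', hB', hW, hP, hWb, hmir, hdiv, hNS, hbd⟩
  · rintro ⟨h₁, h₂⟩ hH
    obtain ⟨W, P, V, Q, C, F, C', hB, hW, hP, hWb, hmir, hdiv, hNS, hbd⟩ := h₂ (h₁ hH)
    exact ⟨W, P, V, Q, C, F, C', hB, hW, hP, hWb, hmir, hdiv, hNS, hbd⟩

end Summit.AnomalousDissipation.AnomalousDissipation.Theorems

end
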